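import Literature.NumberTheory.CubicFields.ShintaniDualDensity
import Literature.NumberTheory.CubicFields.ShintaniGammaFactors
import HarnessLib

/-!
# The functional equation (eq:FE) of the Shintani zeta functions `ξ^±(s, Φ_m)` as a hypothesis schema,
# and the diagonal components `θ^ε = √3 ξ⁺ + ε ξ⁻` with their dual Dirichlet series

Topic `Literature/NumberTheory/CubicFields`; built on `ShintaniZetaResidues.lean` (the continuation vocabulary
`IsShintaniEntire Φ sgn Λ`, `shintaniEntire`, `shintaniRes1/56`), `ShintaniDualDensity.lean` (Shintani's pairing,
the dual lattice `IsDualForm = ι(V*(ℤ))`, the Fourier transform `fourierDual Φ = Φ̂_m ∘ ι⁻¹`, `dualAbsCoeff`,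
`dualDensity = δ̂₁`) and `ShintaniGammaFactors.lean` (`ShintaniGamma.delta ε = Δ^ε`).

Bhargava–Taniguchi–Thorne 2023, Theorem 2.4 (p. 10): "The Shintani zeta functions `ξ^±(s, Φ_m)` converge
absolutely for `Re(s) > 1`, have analytic continuation to all of `ℂ`, are holomorphic except for simple poles at
`s = 1` and `s = 5/6`, and satisfy the functional equation
(eq:FE) `Δ(1 − s)·T·ξ(1 − s, Φ_m) = m^{4s} diag(3, −3)·Δ(s)·T·ξ(s, Φ̂_m)`",
where (p. 9) "The dual zeta functions `ξ^{*,±}(s, Ψ_m)` are defined … by a variant of (12): the sum is now over all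
`GL₂(ℤ)`-orbits in the dual lattice `V*(ℤ)` … we identify `V*(ℤ)` with its image [`3 ∣ b, c`] in `V(ℤ)` … We use `ι`
to regard `Φ̂_m` as a function on `V(ℤ)`, and write `Φ̂_m(x) = 0` for all `x ∈ V(ℤ)` not in the image of `ι`. With
this convention, `ξ^{*,±}(s, Φ̂_m) = ξ^±(s, Φ̂_m)`", `T = ((√3, 1), (√3, −1))`, `ξ = (ξ⁺, ξ⁻)ᵀ`,
`Δ = diag(Δ⁺, Δ⁻)`. Row by row, with the DIAGONAL COMPONENTS `θ^ε(s, ·) := √3 ξ⁺(s, ·) + ε ξ⁻(s, ·)` (`ε = ±1`;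
as in the proof of Thm 3.1, p. 11: "We apply Landau's method to the diagonalized zeta functions
`√3 ξ⁺(s, Φ_m) ± ξ⁻(s, Φ_m)`"), (eq:FE) reads

  `Δ^ε(1 − s) θ^ε(1 − s, Φ_m) = 3ε · m^{4s} · Δ^ε(s) θ^ε(s, Φ̂_m)`   (`ε = ±1`).

This file DEFINES the objects of this identity on the tree's genuine Shintani data —

* `dualCoeffWeight Φ` — `Φ̂_m ∘ ι⁻¹` on the dual lattice, `0` off it (BTT's convention), and
  `shintaniDualCoeff Φ sgn n := a^{sgn}(Φ̂_m, n)`, the coefficients of the dual zeta function `ξ^±(s, Φ̂_m)`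
  (`|a^{sgn}(Φ̂_m, n)| ≤ a^{sgn}(|Φ̂_m|, n) = dualAbsCoeff`, `norm_shintaniDualCoeff_le`);
* `dualTheta ε Φ s := √3 ξ⁺(s, Φ̂_m) + ε ξ⁻(s, Φ̂_m)` (Mathlib `LSeries`, meaningful where it converges);
* `thetaNum ε Φ := √3 Λ⁺ + ε Λ⁻` (entire: `differentiable_thetaNum`) and
  `thetaCont ε Φ s := thetaNum ε Φ s/((s − 1)(s − 5/6))` — the continuation of `θ^ε(s, Φ_m)` (equal to
  `√3 ξ⁺(s, Φ_m) + ε ξ⁻(s, Φ_m)` on `Re s > 1` when the continuations exist, `thetaCont_eq_of_one_lt_re`;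
  holomorphic off `{1, 5/6}` with the displayed simple-pole structure, `thetaCont_eq_div_sub_one`,
  `thetaCont_eq_div_sub`);

— and SPELLS OUT Theorem 2.4 (continuation + (eq:FE)) for one `Φ_m` as the HYPOTHESIS SCHEMA `HasShintaniFE Φ`
(a `Prop`-valued structure; nothing is asserted here, and this seat may not vendor the closed statement as a named
fact, D-0026). The identity is required on the open vertical strip `1 < Re s < 7/6`, where every `Γ`-factor of
`Δ^ε(s)` and `Δ^ε(1 − s)` is finite and non-zero (so Mathlib's junk values of `Γ` at its poles never enter; by the
identity theorem this is equivalent to the meromorphic identity). The schema also records the standard growth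
hypothesis of Landau's method — `Λ^±(s) = (s − 1)(s − 5/6)ξ^±(s, Φ_m)` has finite order in vertical strips (BTT
p. 11: "As `ξ(s)` grows polynomially on this line as `|Im(s)| → ∞`"; [LDTT] §2.1: "there exists a meromorphic
function `χ` … `lim_{|t|→∞} χ(σ + it) = 0` uniformly in every interval") — which is part of the Sato–Shintani theory
behind Theorem 2.4 (the zeta integrals are entire functions bounded in vertical strips) and is what makes the contour
shift of §3 legitimate. Consumers: the Bessel-free Landau theorem (`UniformLandauShintani*.lean`).

## References

* M. Bhargava, T. Taniguchi, F. Thorne, *Improved error estimates for the Davenport–Heilbronn theorems*,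
  Math. Ann. 389 (2024) = arXiv:2107.12819, §2.4 (Thm 2.4, (eq:FE), the dual zeta functions, `Δ^±`, `T`) and §3
  (proof of Thm 3.1, the diagonalised zeta functions). [BhargavaTaniguchiThorne2023]
* D. Lowry-Duda, T. Taniguchi, F. Thorne, *Uniform bounds for lattice point counting and partial sums of zeta
  functions*, Math. Z. 300 (2022) = arXiv:1710.02190, §2.1 (the functional equation and meromorphic continuation
  hypotheses of the uniform Landau theorem). [LowrydudaTaniguchiThorne2017]
* T. Shintani, *On Dirichlet series whose coefficients are class numbers of integral binary cubic forms*, J. Math.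
  Soc. Japan 24 (1972), Thm 1, Thm 2 (continuation, functional equation). [Shintani1972]
-/

noncomputable section

open Complex

namespace Literature.NumberTheory.CubicFields

variable {m : ℕ}

/-! ### The dual coefficients `a^±(Φ̂_m, n)` and the dual diagonal components -/

/-- **`Φ̂_m` as a weight on `V(ℤ)`**: `Φ̂_m(ι⁻¹ f)` on the dual lattice `{3 ∣ b, 3 ∣ c}`, and `0` off it ("we write
`Φ̂_m(x) = 0` for all `x ∈ V(ℤ)` not in the image of `ι`"). [cite: BhargavaTaniguchiThorne2023, §2.4 (the convention Φ̂_m ∘ ι⁻¹, zero off ι(V*(ℤ)))] -/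
def dualCoeffWeight (Φ : BinaryCubic (ZMod m) → ℂ) (f : BinaryCubic ℤ) : ℂ :=
  if IsDualForm f then fourierDual Φ f else 0

/-- `|dualCoeffWeight Φ f| = dualWeight Φ f` (the latter is the real number `|Φ̂_m(ι⁻¹f)|` or `0`). [folklore] -/
theorem norm_dualCoeffWeight (Φ : BinaryCubic (ZMod m) → ℂ) (f : BinaryCubic ℤ) :
    ((‖dualCoeffWeight Φ f‖ : ℝ) : ℂ) = dualWeight Φ f := by
  unfold dualCoeffWeight dualWeight; split_ifs <;> simp

/-- **`a^{sgn}(Φ̂_m, n)`**, the `n`-th coefficient of the dual zeta function `ξ^{sgn}(s, Φ̂_m)`: the sum over the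
`GL₂(ℤ)`-orbits of discriminant `sgn·n` lying in the dual lattice of `Φ̂_m(ι⁻¹x)/|Stab(x)|`.
[cite: BhargavaTaniguchiThorne2023, §2.4 (the dual zeta functions ξ^{*,±}(s, Φ̂_m) = ξ^±(s, Φ̂_m))] -/
def shintaniDualCoeff (Φ : BinaryCubic (ZMod m) → ℂ) (sgn : ℤ) (n : ℕ) : ℂ :=
  shintaniCoeffWith (dualCoeffWeight Φ) (sgn * n)

/-- **`|a^{sgn}(Φ̂_m, n)| ≤ a^{sgn}(|Φ̂_m|, n)`** (triangle inequality over the finitely many orbits of discriminant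
`sgn·n ≠ 0`); the right side is the coefficient entering `δ̂₁(Φ_m)` (Thm 3.1 (18)). [folklore] -/
theorem norm_shintaniDualCoeff_le (Φ : BinaryCubic (ZMod m) → ℂ) {sgn : ℤ} (hs : sgn = 1 ∨ sgn = -1) {n : ℕ}
    (hn : n ≠ 0) : ‖shintaniDualCoeff Φ sgn n‖ ≤ (dualAbsCoeff Φ sgn n).re := by
  have hD : (sgn * n : ℤ) ≠ 0 := by rcases hs with rfl | rfl <;> simp [hn]
  haveI := finite_orbitsOfDisc hD
  haveI : Fintype (orbitsOfDisc (sgn * n)) := Fintype.ofFinite _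
  unfold shintaniDualCoeff dualAbsCoeff shintaniCoeffWith
  rw [finsum_eq_sum_of_fintype, finsum_eq_sum_of_fintype, Complex.re_sum]
  refine (norm_sum_le _ _).trans (Finset.sum_le_sum fun O _ => le_of_eq ?_)
  rw [norm_div, Complex.norm_natCast, ← norm_dualCoeffWeight, ← Complex.ofReal_natCast, ← Complex.ofReal_div,
    Complex.ofReal_re]

/-- **`θ^ε(s, Φ̂_m) := √3 ξ⁺(s, Φ̂_m) + ε ξ⁻(s, Φ̂_m)`**, the dual diagonal components as Dirichlet series (Mathlib
`LSeries`; equal to the sum wherever it converges). [cite: BhargavaTaniguchiThorne2023, §3 (proof of Thm 3.1: ξ(s, Φ̂_m) := √3 ξ⁺(s, Φ̂_m) ± ξ⁻(s, Φ̂_m))] -/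
def dualTheta (ε : ℤ) (Φ : BinaryCubic (ZMod m) → ℂ) (s : ℂ) : ℂ :=
  (Real.sqrt 3 : ℂ) * LSeries (fun n => shintaniDualCoeff Φ 1 n) s + (ε : ℂ) * LSeries (fun n => shintaniDualCoeff Φ (-1) n) s

/-! ### The continuation `θ^ε_cont(s, Φ_m) = (√3 Λ⁺(s) + ε Λ⁻(s))/((s − 1)(s − 5/6))` -/

/-- `shintaniEntire Φ sgn` is always an entire function (the chosen continuation if one exists, else `0`). [folklore] -/
theorem differentiable_shintaniEntire (Φ : BinaryCubic (ZMod m) → ℂ) (sgn : ℤ) :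
    Differentiable ℂ (shintaniEntire Φ sgn) := by
  classical
  by_cases h : ∃ Λ : ℂ → ℂ, IsShintaniEntire Φ sgn Λ
  · exact (isShintaniEntire_shintaniEntire h).1
  · rw [shintaniEntire, dif_neg h]
    exact differentiable_const 0

/-- **`√3 Λ⁺(s) + ε Λ⁻(s)`**, the numerator of the continued diagonal component (entire).
[cite: BhargavaTaniguchiThorne2023, §3 (proof of Thm 3.1, the diagonalized zeta functions) with Thm 2.4 (continuation)] -/
def thetaNum (ε : ℤ) (Φ : BinaryCubic (ZMod m) → ℂ) (s : ℂ) : ℂ :=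
  (Real.sqrt 3 : ℂ) * shintaniEntire Φ 1 s + (ε : ℂ) * shintaniEntire Φ (-1) s

/-- `thetaNum ε Φ` is entire. [folklore] -/
theorem differentiable_thetaNum (ε : ℤ) (Φ : BinaryCubic (ZMod m) → ℂ) : Differentiable ℂ (thetaNum ε Φ) :=
  ((differentiable_const _).mul (differentiable_shintaniEntire Φ 1)).add
    ((differentiable_const _).mul (differentiable_shintaniEntire Φ (-1)))

/-- **`θ^ε_cont(s, Φ_m) := (√3 Λ⁺(s) + ε Λ⁻(s))/((s − 1)(s − 5/6))`** — the meromorphic continuation of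
`θ^ε(s, Φ_m) = √3 ξ⁺(s, Φ_m) + ε ξ⁻(s, Φ_m)`, with at most simple poles at `1` and `5/6`.
[cite: BhargavaTaniguchiThorne2023, Thm 2.4 (continuation with simple poles at 1, 5/6) and §3 (diagonal components)] -/
def thetaCont (ε : ℤ) (Φ : BinaryCubic (ZMod m) → ℂ) (s : ℂ) : ℂ :=
  thetaNum ε Φ s / ((s - 1) * (s - 5 / 6))

/-- **On `Re s > 1` the continuation is the diagonal Dirichlet series**: if both `ξ^±(·, Φ_m)` have continuations
then `θ^ε_cont(s, Φ_m) = √3 ξ⁺(s, Φ_m) + ε ξ⁻(s, Φ_m)` for `Re s > 1`. [folklore] -/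
theorem thetaCont_eq_of_one_lt_re {Φ : BinaryCubic (ZMod m) → ℂ} (h1 : ∃ Λ : ℂ → ℂ, IsShintaniEntire Φ 1 Λ)
    (h2 : ∃ Λ : ℂ → ℂ, IsShintaniEntire Φ (-1) Λ) (ε : ℤ) {s : ℂ} (hs : 1 < s.re) :
    thetaCont ε Φ s = (Real.sqrt 3 : ℂ) * shintaniZetaMod Φ 1 s + (ε : ℂ) * shintaniZetaMod Φ (-1) s := by
  rw [thetaCont, thetaNum, shintaniZetaMod_eq_div h1 hs, shintaniZetaMod_eq_div h2 hs]
  ring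

/-- `θ^ε_cont` is holomorphic off `{1, 5/6}`. [folklore] -/
theorem differentiableOn_thetaCont (ε : ℤ) (Φ : BinaryCubic (ZMod m) → ℂ) :
    DifferentiableOn ℂ (thetaCont ε Φ) {s : ℂ | s ≠ 1 ∧ s ≠ 5 / 6} := by
  intro s hs
  have h : (s - 1) * (s - 5 / 6) ≠ 0 := mul_ne_zero (sub_ne_zero.2 hs.1) (sub_ne_zero.2 hs.2)
  exact (((differentiable_thetaNum ε Φ) s).div (by fun_prop) h).differentiableWithinAt

/-- **The simple pole at `s = 1`**: `θ^ε_cont(s) = φ(s)/(s − 1)` with `φ(s) = thetaNum(s)/(s − 5/6)` holomorphic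
near `1`, `φ(1) = 6·thetaNum(1) = √3 Res₁ξ⁺ + ε Res₁ξ⁻` (`Res_{s=1}ξ^± = 6Λ^±(1)`). [folklore] -/
theorem thetaCont_eq_div_sub_one (ε : ℤ) (Φ : BinaryCubic (ZMod m) → ℂ) (s : ℂ) :
    thetaCont ε Φ s = (thetaNum ε Φ s / (s - 5 / 6)) / (s - 1) := by
  rw [thetaCont, div_div, mul_comm]

/-- **The simple pole at `s = 5/6`**: `θ^ε_cont(s) = ψ(s)/(s − 5/6)` with `ψ(s) = thetaNum(s)/(s − 1)`. [folklore] -/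
theorem thetaCont_eq_div_sub (ε : ℤ) (Φ : BinaryCubic (ZMod m) → ℂ) (s : ℂ) :
    thetaCont ε Φ s = (thetaNum ε Φ s / (s - 1)) / (s - 5 / 6) := by
  rw [thetaCont, div_div]

/-- The value of `φ(s) = thetaNum(s)/(s − 5/6)` at `s = 1` is `√3 Res₁ξ⁺ + ε Res₁ξ⁻`. [folklore] -/
theorem thetaNum_one_div (ε : ℤ) (Φ : BinaryCubic (ZMod m) → ℂ) :
    thetaNum ε Φ 1 / (1 - 5 / 6) = (Real.sqrt 3 : ℂ) * shintaniRes1 Φ 1 + (ε : ℂ) * shintaniRes1 Φ (-1) := by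
  rw [thetaNum, shintaniRes1, shintaniRes1]
  norm_num
  ring

/-- The value of `ψ(s) = thetaNum(s)/(s − 1)` at `s = 5/6` is `√3 Res_{5/6}ξ⁺ + ε Res_{5/6}ξ⁻`. [folklore] -/
theorem thetaNum_div_five_sixths (ε : ℤ) (Φ : BinaryCubic (ZMod m) → ℂ) :
    thetaNum ε Φ (5 / 6) / (5 / 6 - 1) = (Real.sqrt 3 : ℂ) * shintaniRes56 Φ 1 + (ε : ℂ) * shintaniRes56 Φ (-1) := by
  rw [thetaNum, shintaniRes56, shintaniRes56]
  norm_num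
  ring

/-- `θ^ε_cont(0) = (6/5)·thetaNum(0)`, a finite value (`θ^ε(0, Φ_m)`, whose size `≪ δ̂₁(Φ_m)` is (part of) the
`X⁰`-term of Landau's method). [folklore] -/
theorem thetaCont_zero (ε : ℤ) (Φ : BinaryCubic (ZMod m) → ℂ) : thetaCont ε Φ 0 = 6 / 5 * thetaNum ε Φ 0 := by
  rw [thetaCont]; norm_num; ring

/-! ### Theorem 2.4 (continuation + (eq:FE) + finite order) for one `Φ_m`, as a hypothesis schema -/

/-- **The content of Bhargava–Taniguchi–Thorne 2023, Theorem 2.4 — analytic continuation and the functional equation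
(eq:FE) — for one function `Φ_m : V(ℤ/mℤ) → ℂ`**, a HYPOTHESIS SCHEMA (a `Prop`-valued structure with parameters;
nothing is asserted here): (i) "`ξ^±(s, Φ_m)` … have analytic continuation to all of `ℂ`, holomorphic except for simple
poles at `s = 1` and `s = 5/6`" (`exists_entire`, the vocabulary `IsShintaniEntire` of `ShintaniZetaResidues.lean`);
(ii) "(eq:FE) `Δ(1 − s)·T·ξ(1 − s, Φ_m) = m^{4s} diag(3, −3)·Δ(s)·T·ξ(s, Φ̂_m)`", i.e. for the diagonal components
`θ^ε = √3 ξ⁺ + ε ξ⁻` (`T = ((√3, 1), (√3, −1))`, `Δ = diag(Δ⁺, Δ⁻)`):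
`θ^ε_cont(1 − s, Φ_m) = 3ε · m^{4s} · (Δ^ε(s)/Δ^ε(1 − s)) · θ^ε(s, Φ̂_m)` on the strip `1 < Re s < 7/6` (where all
`Γ`-factors are finite and non-zero and the dual series is meant where it converges — it does for `Re s > 1`)
(`fe`); (iii) the standard finite-order growth of `Λ^±(s) = (s − 1)(s − 5/6) ξ^±(s, Φ_m)` in vertical strips, used on
p. 11 ("As `ξ(s)` grows polynomially on this line as `|Im(s)| → ∞`") to shift the contour (`finiteOrder`). The proof is
the Sato–Shintani theory of the prehomogeneous vector space of binary cubic forms (Shintani 1972; Datskovsky–Wright;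
F. Sato), not in Mathlib.
[cite: BhargavaTaniguchiThorne2023, Thm 2.4 (analytic continuation and the functional equation (eq:FE)), §3 p. 11 (growth on vertical lines)] -/
structure HasShintaniFE (Φ : BinaryCubic (ZMod m) → ℂ) : Prop where
  /-- (i) analytic continuation of `ξ^±(s, Φ_m)` with at most simple poles at `1` and `5/6` -/
  exists_entire : ∀ sgn : ℤ, (sgn = 1 ∨ sgn = -1) → ∃ Λ : ℂ → ℂ, IsShintaniEntire Φ sgn Λ
  /-- (ii) the functional equation (eq:FE), diagonal component `ε`, on the strip `1 < Re s < 7/6` -/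
  fe : ∀ ε : ℤ, (ε = 1 ∨ ε = -1) → ∀ s : ℂ, 1 < s.re → s.re < 7 / 6 →
    thetaCont ε Φ (1 - s) =
      3 * (ε : ℂ) * (m : ℂ) ^ (4 * s) * (ShintaniGamma.delta ε s / ShintaniGamma.delta ε (1 - s)) * dualTheta ε Φ s
  /-- (iii) finite order of `Λ^±` in vertical strips -/
  finiteOrder : ∀ sgn : ℤ, (sgn = 1 ∨ sgn = -1) → ∀ a b : ℝ, ∃ C : ℝ, ∀ s : ℂ, a ≤ s.re → s.re ≤ b →
    ‖shintaniEntire Φ sgn s‖ ≤ C * Real.exp (C * |s.im|)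

namespace HasShintaniFE

variable {Φ : BinaryCubic (ZMod m) → ℂ}

/-- Under the schema, `θ^ε_cont = √3 ξ⁺ + ε ξ⁻` on `Re s > 1`. [folklore] -/
theorem thetaCont_eq (h : HasShintaniFE Φ) (ε : ℤ) {s : ℂ} (hs : 1 < s.re) :
    thetaCont ε Φ s = (Real.sqrt 3 : ℂ) * shintaniZetaMod Φ 1 s + (ε : ℂ) * shintaniZetaMod Φ (-1) s :=
  thetaCont_eq_of_one_lt_re (h.exists_entire 1 (Or.inl rfl)) (h.exists_entire (-1) (Or.inr rfl)) ε hs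

/-- Under the schema, `thetaNum ε Φ` has finite order in vertical strips: `‖thetaNum(s)‖ ≤ C e^{C|Im s|}` for
`a ≤ Re s ≤ b`. [folklore] -/
theorem exists_norm_thetaNum_le (h : HasShintaniFE Φ) {ε : ℤ} (hε : ε = 1 ∨ ε = -1) (a b : ℝ) :
    ∃ C : ℝ, 0 < C ∧ ∀ s : ℂ, a ≤ s.re → s.re ≤ b → ‖thetaNum ε Φ s‖ ≤ C * Real.exp (C * |s.im|) := by
  obtain ⟨C₁, h₁⟩ := h.finiteOrder 1 (Or.inl rfl) a b
  obtain ⟨C₂, h₂⟩ := h.finiteOrder (-1) (Or.inr rfl) a b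
  set C : ℝ := max (max C₁ C₂) 1 with hC
  have hC1 : 1 ≤ C := le_max_right _ _
  have hC0 : 0 < C := by linarith
  refine ⟨3 * C, by positivity, fun s ha hb => ?_⟩
  have e1 : ‖shintaniEntire Φ 1 s‖ ≤ C * Real.exp (C * |s.im|) := by
    refine (h₁ s ha hb).trans ?_
    have hle : C₁ ≤ C := (le_max_left _ _).trans (le_max_left _ _)
    have hnn : 0 ≤ ‖shintaniEntire Φ 1 s‖ := norm_nonneg _
    rcases le_or_gt 0 C₁ with h0 | h0
    · exact mul_le_mul hle (Real.exp_le_exp.2 (mul_le_mul_of_nonneg_right hle (abs_nonneg _))) (Real.exp_nonneg _) hC0.le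
    · have : C₁ * Real.exp (C₁ * |s.im|) ≤ 0 := mul_nonpos_of_nonpos_of_nonneg h0.le (Real.exp_nonneg _)
      have : 0 ≤ C * Real.exp (C * |s.im|) := by positivity
      linarith [h₁ s ha hb]
  have e2 : ‖shintaniEntire Φ (-1) s‖ ≤ C * Real.exp (C * |s.im|) := by
    have hle : C₂ ≤ C := (le_max_right _ _).trans (le_max_left _ _)
    rcases le_or_gt 0 C₂ with h0 | h0
    · exact (h₂ s ha hb).trans
        (mul_le_mul hle (Real.exp_le_exp.2 (mul_le_mul_of_nonneg_right hle (abs_nonneg _))) (Real.exp_nonneg _) hC0.le)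
    · have : C₂ * Real.exp (C₂ * |s.im|) ≤ 0 := mul_nonpos_of_nonpos_of_nonneg h0.le (Real.exp_nonneg _)
      have : 0 ≤ C * Real.exp (C * |s.im|) := by positivity
      linarith [h₂ s ha hb]
  have hsqrt : ‖(Real.sqrt 3 : ℂ)‖ ≤ 2 := by
    rw [Complex.norm_real, Real.norm_eq_abs, abs_of_nonneg (Real.sqrt_nonneg _)]
    rw [show (2 : ℝ) = Real.sqrt 4 by rw [show (4 : ℝ) = 2 ^ 2 by norm_num, Real.sqrt_sq zero_le_two]]
    exact Real.sqrt_le_sqrt (by norm_num)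
  have hεn : ‖(ε : ℂ)‖ = 1 := by rcases hε with rfl | rfl <;> simp
  have hexp : Real.exp (C * |s.im|) ≤ Real.exp (3 * C * |s.im|) :=
    Real.exp_le_exp.2 (by nlinarith [abs_nonneg s.im])
  calc ‖thetaNum ε Φ s‖ ≤ ‖(Real.sqrt 3 : ℂ)‖ * ‖shintaniEntire Φ 1 s‖ + ‖(ε : ℂ)‖ * ‖shintaniEntire Φ (-1) s‖ := by
        unfold thetaNum
        exact (norm_add_le _ _).trans (by rw [norm_mul, norm_mul])
    _ ≤ 2 * (C * Real.exp (C * |s.im|)) + 1 * (C * Real.exp (C * |s.im|)) := by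
        rw [hεn]; gcongr
    _ = 3 * C * Real.exp (C * |s.im|) := by ring
    _ ≤ 3 * C * Real.exp (3 * C * |s.im|) := by gcongr

end HasShintaniFE

end Literature.NumberTheory.CubicFields

end
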